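import Mathlib.Algebra.Prime.Defs
import Mathlib.Data.Nat.Prime.Basic
import Mathlib.Data.Int.GCD
import Literature.AlgebraicGeometry.Frobenioids.GroupLikeStandardExample
import HarnessLib

/-!
# Frobenioids I, §3, Example 3.6: proofs of the two named statements

Mochizuki, *The geometry of Frobenioids I: the general theory*, Kyushu J. Math. **62** (2008)
293–400, kurims text p. 70 [cite: MochizukiFrdI2008, Ex. 3.6 p.70].  Discharges the two statements of
`GroupLikeStandardExample.lean` that were typed but not proved there:

* `Ex36.IrreducibleIffPrime` — "the irreducible morphisms of `D` are precisely the morphisms that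
  project via the natural surjection `F_G → N_{≥1}` to primes of `N_{≥1}`" (PROVED: an element of `F_G`
  of Frobenius degree `1` is a unit; `(g, n) = (g, n₁) · (0, n₂)` for `n = n₁ n₂`);
* `Ex36.DSlim` — "`D` is slim": "each automorphism of an object of `D` arising from an element of
  `Aut(D_A → D)` is contained in the subgroup of infinitely divisible elements of `G`, hence is trivial"
  (PROVED: naturality against the arrows `(0, n)` makes the `G`-coordinate `n`-divisible for every `n`,
  and `ℤ ⊕ ⨁_p ℤ/pℤ` has no nonzero infinitely divisible element).
-/

namespace Literature.AlgebraicGeometry.Frobenioids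

open CategoryTheory

namespace Ex36

/-- In `D = SingleObj F_G`, an arrow is an isomorphism iff its Frobenius degree is `1`.
[cite: MochizukiFrdI2008, Ex. 3.6 p.70] -/
theorem isIso_iff_degFr_eq_one {x y : D} (f : x ⟶ y) : IsIso f ↔ (show FG from f).degFr = 1 :=
  (SingleObj.isIso_iff_isUnit f).trans (isUnit_iff_degFr_eq_one _)

/-- **Example 3.6**, "the irreducible morphisms of `D` are precisely the morphisms that project via the
natural surjection `F_G → N_{≥1}` to primes of `N_{≥1}`" (FrdI p. 70; PROVED).
[cite: MochizukiFrdI2008, Ex. 3.6 p.70] -/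
theorem irreducibleIffPrime_holds : IrreducibleIffPrime := by
  intro x y f
  constructor
  · rintro ⟨hni, hirr⟩
    have hn1 : ((show FG from f).degFr : ℕ) ≠ 1 := fun h1 =>
      hni ((isIso_iff_degFr_eq_one f).mpr (PNat.coe_eq_one_iff.mp h1))
    rw [← Nat.irreducible_iff_nat_prime, irreducible_iff]
    refine ⟨by rwa [Nat.isUnit_iff], fun a b hab => ?_⟩
    have ha : 0 < a := Nat.pos_of_ne_zero (by rintro rfl; simp at hab)
    have hb : 0 < b := Nat.pos_of_ne_zero (by rintro rfl; simp at hab)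
    let α : FG := ⟨(show FG from f).div, ⟨a, ha⟩⟩
    let β : FG := ⟨1, ⟨b, hb⟩⟩
    have hαβ : α * β = show FG from f := by
      refine ElemFrobenioidMonoid.ext ?_ (PNat.eq ?_)
      · show (show FG from f).div * (1 : Multiplicative G) ^ a = (show FG from f).div
        rw [one_pow, mul_one]
      · show a * b = ((show FG from f).degFr : ℕ)
        exact hab.symm
    rcases hirr (show x ⟶ x from β) (show x ⟶ y from α)
        (by rw [SingleObj.comp_as_mul]; exact hαβ) with hα | hβ
    · left
      have h1 := congrArg PNat.val ((isIso_iff_degFr_eq_one _).mp hα)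
      exact Nat.isUnit_iff.mpr h1
    · right
      have h1 := congrArg PNat.val ((isIso_iff_degFr_eq_one _).mp hβ)
      exact Nat.isUnit_iff.mpr h1
  · intro hp
    refine ⟨fun hf => hp.ne_one ?_, fun X β α hβα => ?_⟩
    · exact PNat.coe_eq_one_iff.mpr ((isIso_iff_degFr_eq_one f).mp hf)
    · have hmul : (show FG from α) * (show FG from β) = show FG from f := by
        rw [← SingleObj.comp_as_mul]; exact hβα
      have hdeg : ((show FG from α).degFr : ℕ) * (show FG from β).degFr = (show FG from f).degFr := by
        have h1 := congrArg ElemFrobenioidMonoid.degFr hmul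
        rw [ElemFrobenioidMonoid.mul_degFr] at h1
        exact_mod_cast congrArg PNat.val h1
      rw [← hdeg] at hp
      rcases Nat.prime_mul_iff.mp hp with ⟨-, hb1⟩ | ⟨-, ha1⟩
      · exact Or.inr ((isIso_iff_degFr_eq_one _).mpr (PNat.coe_eq_one_iff.mp hb1))
      · exact Or.inl ((isIso_iff_degFr_eq_one _).mpr (PNat.coe_eq_one_iff.mp ha1))

/-- An infinitely divisible element of `G = ℤ ⊕ ⨁_p ℤ/pℤ` is zero ("the subgroup of infinitely
divisible elements of `G` … is trivial", FrdI p. 70, via the proof of Prop. 1.13 (iii); PROVED).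
[cite: MochizukiFrdI2008, Ex. 3.6 p.70] -/
theorem eq_zero_of_forall_nsmul (a : G) (h : ∀ n : ℕ+, ∃ b : G, a = (n : ℕ) • b) : a = 0 := by
  refine Prod.ext ?_ ?_
  · -- the `ℤ`-coordinate: divisible by `|a.1| + 1 > |a.1|`
    obtain ⟨b, hb⟩ := h ⟨a.1.natAbs + 1, Nat.succ_pos _⟩
    have hb1 : a.1 = ((a.1.natAbs + 1 : ℕ) : ℤ) * b.1 := by
      have := congrArg Prod.fst hb
      simp only [Prod.smul_fst, nsmul_eq_mul, PNat.mk_coe] at this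
      exact this
    show a.1 = 0
    refine Int.eq_zero_of_dvd_of_natAbs_lt_natAbs ⟨b.1, hb1⟩ ?_
    rw [Int.natAbs_natCast]
    exact Nat.lt_succ_self _
  · -- the torsion coordinate: the `p`-component of a `p`-divisible element of `⨁ ℤ/pℤ` vanishes
    show a.2 = 0
    refine DFinsupp.ext fun p => ?_
    obtain ⟨b, hb⟩ := h ⟨(p : ℕ), p.2.pos⟩
    have hb2 : a.2 p = ((p : ℕ) • b.2) p := by
      have := congrArg Prod.snd hb
      exact congrFun (congrArg DFunLike.coe this) p
    have key : ∀ (n : ℕ) (x : DirectSum Nat.Primes fun q => ZMod q) (q : Nat.Primes),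
        (n • x) q = n • x q := by
      intro n x q
      induction n with
      | zero => simp [DirectSum.zero_apply]
      | succ n ih => rw [succ_nsmul, succ_nsmul, DirectSum.add_apply, ih]
    rw [hb2, DirectSum.zero_apply, key, nsmul_eq_mul, ZMod.natCast_self, zero_mul]

/-- **Example 3.6**, "`D` is slim" (FrdI p. 70; PROVED): an automorphism `α` of the forgetful functor
`D_A → D` has components of Frobenius degree `1`, and naturality against the arrows `(0, n) ∈ F_G`
shows that their `G`-coordinates are `n`-divisible for every `n`, hence zero.
[cite: MochizukiFrdI2008, Ex. 3.6 p.70] -/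
theorem dSlim_holds : DSlim := by
  refine ⟨fun A α => ?_⟩
  refine Iso.ext (NatTrans.ext (funext fun o => ?_))
  -- the component at `o`, as an element of `F_G`, is a unit
  have hdeg : ∀ o' : Over A, (show FG from α.hom.app o').degFr = 1 := fun o' =>
    (isIso_iff_degFr_eq_one (α.hom.app o')).mp inferInstance
  -- naturality against `k₀ = (0, n)`: the `G`-coordinate is `n`-divisible
  have hdiv : ∀ n : ℕ+, ∃ b : G,
      Multiplicative.toAdd (show FG from α.hom.app o).div = (n : ℕ) • b := by
    intro n
    let k₀ : FG := ⟨1, n⟩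
    let o' : Over A := Over.mk ((show o.left ⟶ o.left from k₀) ≫ o.hom)
    let k : o' ⟶ o := Over.homMk (show o.left ⟶ o.left from k₀) rfl
    have nat := α.hom.naturality k
    -- `nat : k₀ ≫ α_o = α_{o'} ≫ k₀`, i.e. `α_o * k₀ = k₀ * α_{o'}` in `F_G`
    have nat' : (show FG from α.hom.app o) * k₀ = k₀ * (show FG from α.hom.app o') := by
      have := nat
      rw [SingleObj.comp_as_mul, SingleObj.comp_as_mul] at this
      exact this
    refine ⟨Multiplicative.toAdd (show FG from α.hom.app o').div, ?_⟩
    have hdivs := congrArg ElemFrobenioidMonoid.div nat'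
    simp only [ElemFrobenioidMonoid.mul_div, k₀, one_pow, mul_one, one_mul] at hdivs
    rw [hdivs, toAdd_pow]
  have hzero : Multiplicative.toAdd (show FG from α.hom.app o).div = 0 :=
    eq_zero_of_forall_nsmul _ fun n => hdiv n
  -- conclude: the component is `(0, 1) = 1 = 𝟙`
  show α.hom.app o = 𝟙 _
  rw [SingleObj.id_as_one]
  exact ElemFrobenioidMonoid.ext (by simpa using hzero) (hdeg o)

end Ex36

end Literature.AlgebraicGeometry.Frobenioids
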